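import Literature.MathematicalPhysics.QuantumFieldTheory.Balaban1983to89.T4ContinuumCoupling
import Summits.QuantumFields.BalabanUV.Beta.RemainderExplicitHistoryDiagonalSum

/-!
# RemainderExplicitHistoryDiagonalExistence — ROAD P3: THE CONTINUUM COUPLING EXISTS SCALE BY SCALE WITHOUT NE4 AS TYPED —
# bounded diagonal sums `Σ_{n<N} disc(g^{(n+m)}, g^{(n+m+1)}, n) ≤ B_m` (the currency of `RemainderExplicitHistoryDiagonalSum`) give
# `invSq g m n → astar g m`, `|invSq g m n − astar g m| ≤ B_m`, `g^{(n+m)}_n → gstar g m ∈ ]0,γ]`, `gstar g 0 = g_IR`, the limit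
# flow `1∕gstar_{m+1}² = 1∕gstar_m² + bstar_m` with `bstar_m = lim β_n(diagonal) ≥ b`, and `gstar_m ≤ (1∕g_IR² + b·m)^{−1∕2}`;
# END `tendsto_invSq_diag` ∕ `continuum_diag` from a summable scale-shift profile + a summable memory profile + the floor + `Wγ < b`
# (station S-d4p3-g47-1, third file: node U6's `T4ContinuumCoupling` read-outs re-derived from SUMMABILITY instead of a geometric rate)

Cell `pub-balaban`, β-function sub-cell, BINDER row D4 «RemainderConst leaves for Bałaban's split» (`HOME/BINDER-OWNERS.md`; owner
lineage `b2b-balaban-beta-an4`; this file by co-owner #3 lineage `b2b-balaban-beta-d4-p3`, road P3 «the reduction road», generation 47,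
station S-d4p3-g47-1, third file; imports `T4ContinuumCoupling` (node U2∕U6 read-out vocabulary `invSq`, `astar`, `gstar`, `bstar`) and
the station's `RemainderExplicitHistoryDiagonalSum`), β-FLOW TEAM duty (1); FREEZE (0) honoured (def-free module in road P3's own
`RemainderExplicit*` series; no leaf, no interface, no Literature file).  SOURCE OF THE SHAPES ONLY: [Balaban1987RG1] (0.20) p. 256,
(0.31) and Thm 2 p. 259, §1 p. 264, §5 p. 298.  Pure real analysis (Cauchy sequences in `ℝ`).

HONEST FRAMING (page 1 of everything the β sub-cell writes).  *"Discharging BetaPertH makes Bałaban's UV stability UNCONDITIONAL —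
a real constructive-QFT result; it is NOT the continuum limit and NOT the Clay problem."*  THIS FILE DISCHARGES NOTHING OF THE
KIND.  It is the read-out half of station S-d4p3-g47-1 (located census distinction answering journal [D4P2-G35-X20] INFO-1): node
U6's leaf `T4ContinuumCoupling` reads node U2's GEOMETRIC output shape `InjectedRate C 0 θ (disc …)` out as the continuum running
coupling WITH a geometric tail; here the SAME read-outs (all but the tail) are obtained from the weaker, rate-free currency
«the two-run discrepancies have bounded partial sums over the cutoff along every diagonal», which `RemainderExplicitHistoryDiagonalSum`
produces from a summable scale-shift profile, a summable memory profile, the asymptotic-freedom floor and the smallness `Wγ < b` —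
NO NE4 as typed, NO `FadingMemory`, NO renewal.  What is lost is exactly the RATE (`ContinuumRunning.rate`): the closeness bound
`|invSq g m n − astar g m| ≤ B_m` is uniform in the cutoff but does not decay in it.  Every hypothesis on `β` is an UNPRINTED SHAPE
([Balaban1987RG1] p. 264, p. 298; cell GAPS G-t4-U2-1, G-t4-U2-2), consumed as a binder; the family of runs and its pin
(`g K K = gIR`, Theorem 2's renormalization condition) are hypotheses; nothing of Bałaban's (1.22) is asserted or constructed; row D4
class UNCHANGED (critical-path width 0; instance 0∕1; D4 DISCHARGE NO DATE); NOT B12 Thm 2, NOT BetaPertH, NOT continuum, NOT Clay.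
HONEST DEPENDENCY: continuum YM on T⁴ ⇐ BetaPertH ∧ nine spine estimates (0/9 proved); BetaPertH ⇐ (D1) ∧ (D4) ∧ CAP+tail; G-an2-4
gates asym, D1 and NE2/3/4.  ABSOLUTE RULE: nothing is cited as a fact.

WHAT IS PROVED ([folklore]; 0 sorry; 0 `def`).
* §1 FROM BOUNDED DIAGONAL SUMS (`hB : ∀ m N, Σ_{n<N} disc (g (n+m)) (g (n+m+1)) n ≤ B m`, runs in the box): `summable_disc_of_diag_le`,
  **`tendsto_invSq_of_diag_le`** (`invSq g m n → astar g m`: summable consecutive differences ⇒ Cauchy),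
  `abs_invSq_sub_astar_le_tsum_of_diag_le` (the intrinsic tail `≤ Σ_k disc (g (n+k+m)) (g (n+k+m+1)) (n+k)`), `abs_invSq_sub_astar_le_of_diag_le`
  (`|invSq g m n − astar g m| ≤ B m`, uniform in `n`, NO decay), `bound_nonneg_of_diag_le`, `astar_zero_of_diag_le` (`= 1∕g_IR²` under the
  pin), `astar_pos_of_diag_le` (`1∕γ² ≤ astar`, `0 < astar`), `tendsto_coupling_of_diag_le` (`g (n+m) n → gstar g m`), `gstar_pos_le_of_diag_le`
  (`0 < gstar ≤ γ`, `1∕gstar² = astar`), `gstar_zero_of_diag_le` (`gstar g 0 = g_IR`), `tendsto_beta_diag_of_diag_le` (the diagonal β-values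
  converge to `bstar g m`, `beta_diag_eq` BY NAME), `gstar_flow_of_diag_le`
  (`1∕gstar_{m+1}² = 1∕gstar_m² + bstar_m`), `le_bstar_of_diag_le` (`b ≤ bstar` from `BetaLowerH`), `gstar_le_inv_sprof_of_diag_le`
  (logarithmic asymptotic freedom of the limit, `prof_le_invSq` BY NAME).
* §2 END, the binder list of `RemainderExplicitHistoryDiagonalSum.sum_disc_diag_le` (`B m = m·S∕(1 − Wγ∕b)`): **`tendsto_invSq_diag`**,
  `abs_invSq_sub_astar_le_diag`, **`continuum_diag`** (convergence of the couplings at every scale to `gstar g m ∈ ]0,γ]`, `gstar g 0 = g_IR`,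
  diagonal β-limits, the limit flow, `b ≤ bstar`, `gstar_m ≤ 1∕√(1∕g_IR² + b·m)` — the fields of `T4ContinuumCoupling.ContinuumRunning`
  EXCEPT `rate`, as a conjunction).
All letters NOT-IN-PRINT; `BetaFlowAsPrinted S` records a Markov β_n only ⇒ no junction of the as-printed interface changes.
-/

noncomputable section

open Finset Filter Topology

namespace Summit.QuantumFields.BalabanUV.Beta.RemainderExplicitHistoryDiagonalExistence

open Literature.MathematicalPhysics.QuantumFieldTheory.Balaban1983to89
open Literature.MathematicalPhysics.QuantumFieldTheory.Balaban1983to89.FlowStep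
open Literature.MathematicalPhysics.QuantumFieldTheory.Balaban1983to89.T4CouplingMatching
open Literature.MathematicalPhysics.QuantumFieldTheory.Balaban1983to89.T4ContinuumCoupling
open Summit.QuantumFields.BalabanUV.Beta.RemainderExplicitHistoryDiagonalSum (sum_disc_diag_le)

variable {β : HBeta} {g : ℕ → ℕ → ℝ} {B : ℕ → ℝ} {γ gIR b : ℝ}

/-! ## §1 From bounded diagonal sums to the continuum coupling, scale by scale -/

/-- Bounded partial sums of the (nonnegative) discrepancies along a diagonal ⇒ summable. [folklore] -/
theorem summable_disc_of_diag_le (hB : ∀ m N, ∑ n ∈ range N, disc (g (n + m)) (g (n + m + 1)) n ≤ B m) (m : ℕ) :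
    Summable (fun n : ℕ => disc (g (n + m)) (g (n + m + 1)) n) :=
  summable_of_sum_range_le (fun _ => disc_nonneg _ _ _) (hB m)

/-- **THE RECURSION VARIABLES CONVERGE AS THE CUTOFF IS REMOVED, scale by scale, from SUMMABILITY alone**: bounded diagonal sums ⇒
`invSq g m n = 1∕(g (n+m) n)² → astar g m` (`T4ContinuumCoupling.astar`, the intrinsic `limUnder`): consecutive differences
`|invSq g m (n+1) − invSq g m n| = disc (g (n+m)) (g (n+m+1)) n` are summable, the sequence is Cauchy in `ℝ`. [folklore] -/
theorem tendsto_invSq_of_diag_le (hB : ∀ m N, ∑ n ∈ range N, disc (g (n + m)) (g (n + m + 1)) n ≤ B m) (m : ℕ) :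
    Tendsto (invSq g m) atTop (𝓝 (astar g m)) := by
  have hsum := summable_disc_of_diag_le hB m
  have hcau : CauchySeq (invSq g m) := by
    refine cauchySeq_of_summable_dist (hsum.congr fun n => ?_)
    rw [Real.dist_eq, abs_sub_comm, abs_invSq_succ_sub]
  obtain ⟨a, ha⟩ := cauchySeq_tendsto_of_complete hcau
  exact tendsto_nhds_limUnder ⟨a, ha⟩

/-- THE INTRINSIC TAIL: `|invSq g m n − astar g m| ≤ Σ_k disc (g (n+k+m)) (g (n+k+m+1)) (n+k)` — the distance to the limit is at most
the tail of the summable diagonal series (`dist_le_tsum_of_dist_le_of_tendsto`); the only «rate» summability alone provides. [folklore] -/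
theorem abs_invSq_sub_astar_le_tsum_of_diag_le (hB : ∀ m N, ∑ n ∈ range N, disc (g (n + m)) (g (n + m + 1)) n ≤ B m)
    (m n : ℕ) : |invSq g m n - astar g m| ≤ ∑' k : ℕ, disc (g (n + k + m)) (g (n + k + m + 1)) (n + k) := by
  have hsum := summable_disc_of_diag_le hB m
  have hd : ∀ k, dist (invSq g m k) (invSq g m k.succ) ≤ disc (g (k + m)) (g (k + m + 1)) k := fun k => by
    rw [Real.dist_eq, abs_sub_comm, Nat.succ_eq_add_one, abs_invSq_succ_sub]
  have h := dist_le_tsum_of_dist_le_of_tendsto (fun k => disc (g (k + m)) (g (k + m + 1)) k) hd hsum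
    (tendsto_invSq_of_diag_le hB m) n
  rwa [Real.dist_eq] at h

/-- **UNIFORM CLOSENESS, NO RATE**: `|invSq g m n − astar g m| ≤ B m` for every cutoff `n` (the intrinsic tail has partial sums `≤ B m`).
[folklore] -/
theorem abs_invSq_sub_astar_le_of_diag_le (hB : ∀ m N, ∑ n ∈ range N, disc (g (n + m)) (g (n + m + 1)) n ≤ B m)
    (m n : ℕ) : |invSq g m n - astar g m| ≤ B m := by
  refine (abs_invSq_sub_astar_le_tsum_of_diag_le hB m n).trans
    (Real.tsum_le_of_sum_range_le (fun k => disc_nonneg _ _ _) fun N => ?_)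
  calc ∑ k ∈ range N, disc (g (n + k + m)) (g (n + k + m + 1)) (n + k)
      ≤ ∑ k ∈ range (n + N), disc (g (k + m)) (g (k + m + 1)) k := by
        have e : ∑ k ∈ range N, disc (g (n + k + m)) (g (n + k + m + 1)) (n + k)
            = ∑ k ∈ Ico n (n + N), disc (g (k + m)) (g (k + m + 1)) k := by
          rw [Finset.sum_Ico_eq_sum_range, Nat.add_sub_cancel_left]
        rw [e]
        exact Finset.sum_le_sum_of_subset_of_nonneg
          (fun k hk => Finset.mem_range.mpr (Finset.mem_Ico.mp hk).2) fun _ _ _ => disc_nonneg _ _ _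
    _ ≤ B m := hB m (n + N)

/-- The bound is nonnegative wherever it holds (`N = 0`). [folklore] -/
theorem bound_nonneg_of_diag_le (hB : ∀ m N, ∑ n ∈ range N, disc (g (n + m)) (g (n + m + 1)) n ≤ B m) (m : ℕ) :
    0 ≤ B m := by simpa using hB m 0

/-- THE PIN SURVIVES: `astar g 0 = 1∕g_IR²` (`invSq g 0 n = 1∕g_IR²` for every cutoff, `invSq_zero`). [folklore] -/
theorem astar_zero_of_diag_le (hB : ∀ m N, ∑ n ∈ range N, disc (g (n + m)) (g (n + m + 1)) n ≤ B m)
    (hpin : ∀ K, g K K = gIR) : astar g 0 = 1 / gIR ^ 2 :=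
  tendsto_nhds_unique (tendsto_invSq_of_diag_le hB 0) ((tendsto_congr (invSq_zero hpin)).2 tendsto_const_nhds)

/-- `1∕γ² ≤ astar g m` (the box passes to the limit), hence `0 < astar g m`. [folklore] -/
theorem astar_pos_of_diag_le (hB : ∀ m N, ∑ n ∈ range N, disc (g (n + m)) (g (n + m + 1)) n ≤ B m)
    (hbox : ∀ K i, i ≤ K → 0 < g K i ∧ g K i ≤ γ) (m : ℕ) : 1 / γ ^ 2 ≤ astar g m ∧ 0 < astar g m := by
  have h1 : 1 / γ ^ 2 ≤ astar g m :=
    ge_of_tendsto' (tendsto_invSq_of_diag_le hB m) fun n => inv_sq_gamma_le_invSq hbox m n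
  obtain ⟨h0, hγ⟩ := hbox 0 0 le_rfl
  have hγ0 : 0 < γ := h0.trans_le hγ
  exact ⟨h1, lt_of_lt_of_le (by positivity) h1⟩

/-- **THE EFFECTIVE COUPLINGS CONVERGE AS THE CUTOFF IS REMOVED**: `g (n+m) n → gstar g m = 1∕√(astar g m)` at every physical
scale `m`. [folklore] -/
theorem tendsto_coupling_of_diag_le (hB : ∀ m N, ∑ n ∈ range N, disc (g (n + m)) (g (n + m + 1)) n ≤ B m)
    (hbox : ∀ K i, i ≤ K → 0 < g K i ∧ g K i ≤ γ) (m : ℕ) :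
    Tendsto (fun n => g (n + m) n) atTop (𝓝 (gstar g m)) := by
  have ha := (astar_pos_of_diag_le hB hbox m).2
  have h1 : Tendsto (fun n => 1 / Real.sqrt (invSq g m n)) atTop (𝓝 (gstar g m)) :=
    tendsto_const_nhds.div (tendsto_invSq_of_diag_le hB m).sqrt (Real.sqrt_pos.mpr ha).ne'
  exact (tendsto_congr fun n => one_div_sqrt_invSq hbox m n).1 h1

/-- `0 < gstar g m ≤ γ` and `1∕(gstar g m)² = astar g m`. [folklore] -/
theorem gstar_pos_le_of_diag_le (hB : ∀ m N, ∑ n ∈ range N, disc (g (n + m)) (g (n + m + 1)) n ≤ B m)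
    (hbox : ∀ K i, i ≤ K → 0 < g K i ∧ g K i ≤ γ) (m : ℕ) :
    0 < gstar g m ∧ gstar g m ≤ γ ∧ 1 / (gstar g m) ^ 2 = astar g m := by
  have ha := (astar_pos_of_diag_le hB hbox m).2
  refine ⟨one_div_pos.mpr (Real.sqrt_pos.mpr ha),
    le_of_tendsto' (tendsto_coupling_of_diag_le hB hbox m) fun n => (hbox (n + m) n (Nat.le_add_right n m)).2, ?_⟩
  unfold gstar
  rw [div_pow, one_pow, Real.sq_sqrt ha.le, one_div_one_div]

/-- THE RENORMALIZATION CONDITION SURVIVES: `gstar g 0 = g_IR`. [folklore] -/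
theorem gstar_zero_of_diag_le (hB : ∀ m N, ∑ n ∈ range N, disc (g (n + m)) (g (n + m + 1)) n ≤ B m)
    (hbox : ∀ K i, i ≤ K → 0 < g K i ∧ g K i ≤ γ) (hpin : ∀ K, g K K = gIR) : gstar g 0 = gIR := by
  have hgIR : 0 < gIR := by rw [← hpin 0]; exact (hbox 0 0 le_rfl).1
  unfold gstar
  rw [astar_zero_of_diag_le hB hpin, ← one_div_pow, Real.sqrt_sq (by positivity), one_div_one_div]

/-- **THE DIAGONAL β-VALUES CONVERGE** under the run-wise recursion (0.20) (`∀ K, RGEqH K β (g K)`): `β n (g (n+m+1))_{0..n} → bstar g m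
= astar g (m+1) − astar g m` (`T4ContinuumCoupling.beta_diag_eq` BY NAME). [cite: Balaban1987RG1, (0.20) p.256] -/
theorem tendsto_beta_diag_of_diag_le (hB : ∀ m N, ∑ n ∈ range N, disc (g (n + m)) (g (n + m + 1)) n ≤ B m)
    (hrun : ∀ K, RGEqH K β (g K)) (m : ℕ) :
    Tendsto (fun n => β n (prefixOf (g (n + m + 1)) n)) atTop (𝓝 (bstar g m)) := by
  have h1 := tendsto_invSq_of_diag_le hB (m + 1)
  have h2 : Tendsto (fun n => invSq g m (n + 1)) atTop (𝓝 (astar g m)) :=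
    (tendsto_invSq_of_diag_le hB m).comp (tendsto_add_atTop_nat 1)
  have h : Tendsto (fun n => invSq g (m + 1) n - invSq g m (n + 1)) atTop (𝓝 (bstar g m)) := h1.sub h2
  exact (tendsto_congr fun n => beta_diag_eq hrun m n).2 h

/-- **THE LIMIT FLOW**: `1∕(gstar g (m+1))² = 1∕(gstar g m)² + bstar g m` — (0.20) in the continuum, read upward from `gstar g 0 = g_IR`.
[cite: Balaban1987RG1, (0.20) p.256] -/
theorem gstar_flow_of_diag_le (hB : ∀ m N, ∑ n ∈ range N, disc (g (n + m)) (g (n + m + 1)) n ≤ B m)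
    (hbox : ∀ K i, i ≤ K → 0 < g K i ∧ g K i ≤ γ) (m : ℕ) :
    1 / (gstar g (m + 1)) ^ 2 = 1 / (gstar g m) ^ 2 + bstar g m := by
  rw [(gstar_pos_le_of_diag_le hB hbox (m + 1)).2.2, (gstar_pos_le_of_diag_le hB hbox m).2.2, astar_succ]

/-- The floor passes to the limit: `BetaLowerH b γ β` ⇒ `b ≤ bstar g m` (the diagonal prefixes lie in the boxes). [folklore] -/
theorem le_bstar_of_diag_le (hB : ∀ m N, ∑ n ∈ range N, disc (g (n + m)) (g (n + m + 1)) n ≤ B m)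
    (hrun : ∀ K, RGEqH K β (g K)) (hbox : ∀ K i, i ≤ K → 0 < g K i ∧ g K i ≤ γ) (hlo : BetaLowerH b γ β) (m : ℕ) :
    b ≤ bstar g m :=
  ge_of_tendsto' (tendsto_beta_diag_of_diag_le hB hrun m) fun n =>
    hlo n _ (prefixOf_mem_box (by omega) (hbox (n + m + 1)))

/-- **LOGARITHMIC ASYMPTOTIC FREEDOM OF THE LIMIT**: under the floor and the pin, `1∕g_IR² + b·m ≤ astar g m` and
`gstar g m ≤ 1∕√(1∕g_IR² + b·m)` (`T4ContinuumCoupling.prof_le_invSq` BY NAME, passed to the limit). [cite: Balaban1987RG1, (0.31) p.259] -/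
theorem gstar_le_inv_sprof_of_diag_le (hB : ∀ m N, ∑ n ∈ range N, disc (g (n + m)) (g (n + m + 1)) n ≤ B m)
    (hrun : ∀ K, RGEqH K β (g K)) (hbox : ∀ K i, i ≤ K → 0 < g K i ∧ g K i ≤ γ) (hpin : ∀ K, g K K = gIR)
    (hlo : BetaLowerH b γ β) (hb : 0 ≤ b) (m : ℕ) :
    prof gIR b m ≤ astar g m ∧ gstar g m ≤ 1 / sprof gIR b m := by
  have hgIR : 0 < gIR := by rw [← hpin 0]; exact (hbox 0 0 le_rfl).1
  have h1 : prof gIR b m ≤ astar g m :=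
    ge_of_tendsto' (tendsto_invSq_of_diag_le hB m) fun n =>
      prof_le_invSq hrun hbox hpin (eventualLowerH_of_betaLowerH hlo 0) (Nat.zero_le n)
  refine ⟨h1, ?_⟩
  unfold gstar sprof
  exact one_div_le_one_div_of_le (Real.sqrt_pos.mpr (prof_pos hgIR hb m)) (Real.sqrt_le_sqrt h1)

/-! ## §2 END: the continuum coupling from a summable scale shift and a summable memory, no NE4 as typed, no fading memory -/

/-- **ROAD P3 — THE CONTINUUM RECURSION VARIABLE EXISTS AT EVERY SCALE WITHOUT NE4 AS TYPED AND WITHOUT FADING MEMORY.**  Under the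
binder list of `RemainderExplicitHistoryDiagonalSum.sum_disc_diag_le` — runs of (0.20) in ]0,γ] pinned at `g_IR`, a scale-shift
PROFILE `|β_{k+2}(w) − β_{k+1}(Fin.tail w)| ≤ σ_k` with `Σ_{l<n} σ_l ≤ S`, history moduli `0 ≤ Λ k i ≤ ρ(k − i)` with `Σ_{a<n} ρ_a ≤ W`,
the floor `BetaLowerH b γ β` (`b > 0`), smallness `W·γ < b` — `invSq g m n → astar g m` for every `m`.  Node U2's
`tendsto_invSq` needs `InjectedRate C 0 θ` with `θ < 1`; (E33d)'s `tendsto_invSq_of_stretched` needs the stretched shape from NE4 as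
typed; here neither. [cite: Balaban1987RG1, (0.20) p.256 and Thm 2 p.259] -/
theorem tendsto_invSq_diag {S W : ℝ} {σ ρ : ℕ → ℝ} {Λ : ℕ → ℕ → ℝ} (g : ℕ → ℕ → ℝ) (gIR : ℝ)
    (hγ : 0 < γ) (hb : 0 < b) (hσ0 : ∀ l, 0 ≤ σ l) (hρ0 : ∀ a, 0 ≤ ρ a)
    (hσS : ∀ n, ∑ l ∈ range n, σ l ≤ S) (hρW : ∀ n, ∑ a ∈ range n, ρ a ≤ W) (hsmall : W * γ < b)
    (hrun : ∀ K, RGEqH K β (g K)) (hbox : ∀ K i, i ≤ K → 0 < g K i ∧ g K i ≤ γ) (hpin : ∀ K, g K K = gIR)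
    (hS : ∀ k (w : Fin (k + 2) → ℝ), w ∈ Box γ (k + 1) → |β (k + 1) w - β k (Fin.tail w)| ≤ σ k)
    (hL : HistLipschitz Λ γ β) (hΛ0 : ∀ k i, i ≤ k → 0 ≤ Λ k i) (hΛρ : ∀ k i, i ≤ k → Λ k i ≤ ρ (k - i))
    (hlo : BetaLowerH b γ β) (m : ℕ) : Tendsto (invSq g m) atTop (𝓝 (astar g m)) :=
  tendsto_invSq_of_diag_le (B := fun m => (m : ℝ) * S / (1 - W * γ / b))
    (sum_disc_diag_le g gIR hγ hb hσ0 hρ0 hσS hρW hsmall hrun hbox hpin hS hL hΛ0 hΛρ hlo) m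

/-- **UNIFORM CLOSENESS, LINEAR IN THE INFRARED DISTANCE**: under the same binders `|1∕(g^{(n+m)}_n)² − astar g m| ≤ m·S∕(1 − Wγ∕b)` for
every cutoff — the K-uniform bound that replaces node U2's geometric tail `Cθ^n∕(1−θ)` when only summability is available. [folklore] -/
theorem abs_invSq_sub_astar_le_diag {S W : ℝ} {σ ρ : ℕ → ℝ} {Λ : ℕ → ℕ → ℝ} (g : ℕ → ℕ → ℝ) (gIR : ℝ)
    (hγ : 0 < γ) (hb : 0 < b) (hσ0 : ∀ l, 0 ≤ σ l) (hρ0 : ∀ a, 0 ≤ ρ a)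
    (hσS : ∀ n, ∑ l ∈ range n, σ l ≤ S) (hρW : ∀ n, ∑ a ∈ range n, ρ a ≤ W) (hsmall : W * γ < b)
    (hrun : ∀ K, RGEqH K β (g K)) (hbox : ∀ K i, i ≤ K → 0 < g K i ∧ g K i ≤ γ) (hpin : ∀ K, g K K = gIR)
    (hS : ∀ k (w : Fin (k + 2) → ℝ), w ∈ Box γ (k + 1) → |β (k + 1) w - β k (Fin.tail w)| ≤ σ k)
    (hL : HistLipschitz Λ γ β) (hΛ0 : ∀ k i, i ≤ k → 0 ≤ Λ k i) (hΛρ : ∀ k i, i ≤ k → Λ k i ≤ ρ (k - i))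
    (hlo : BetaLowerH b γ β) (m n : ℕ) : |invSq g m n - astar g m| ≤ (m : ℝ) * S / (1 - W * γ / b) :=
  abs_invSq_sub_astar_le_of_diag_le (B := fun m => (m : ℝ) * S / (1 - W * γ / b))
    (sum_disc_diag_le g gIR hγ hb hσ0 hρ0 hσS hρW hsmall hrun hbox hpin hS hL hΛ0 hΛρ hlo) m n

/-- **ROAD P3 — THE CONTINUUM RUNNING COUPLING WITHOUT NE4 AS TYPED** (every field of `T4ContinuumCoupling.ContinuumRunning` EXCEPT the
geometric `rate`, under the binder list of `sum_disc_diag_le`): at every physical scale `m` the couplings `g^{(n+m)}_n` converge to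
`gstar g m ∈ ]0, γ]`, `gstar g 0 = g_IR`, the diagonal β-values converge to `bstar g m`, the LIMIT FLOW `1∕gstar_{m+1}² = 1∕gstar_m² + bstar_m`
holds with `b ≤ bstar_m`, and `gstar_m ≤ 1∕√(1∕g_IR² + b·m)` (logarithmic asymptotic freedom).  Existence only: NO rate in the cutoff
is asserted. [cite: Balaban1987RG1, (0.20) p.256, (0.31) and Thm 2 p.259] -/
theorem continuum_diag {S W : ℝ} {σ ρ : ℕ → ℝ} {Λ : ℕ → ℕ → ℝ} (g : ℕ → ℕ → ℝ) (gIR : ℝ)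
    (hγ : 0 < γ) (hb : 0 < b) (hσ0 : ∀ l, 0 ≤ σ l) (hρ0 : ∀ a, 0 ≤ ρ a)
    (hσS : ∀ n, ∑ l ∈ range n, σ l ≤ S) (hρW : ∀ n, ∑ a ∈ range n, ρ a ≤ W) (hsmall : W * γ < b)
    (hrun : ∀ K, RGEqH K β (g K)) (hbox : ∀ K i, i ≤ K → 0 < g K i ∧ g K i ≤ γ) (hpin : ∀ K, g K K = gIR)
    (hS : ∀ k (w : Fin (k + 2) → ℝ), w ∈ Box γ (k + 1) → |β (k + 1) w - β k (Fin.tail w)| ≤ σ k)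
    (hL : HistLipschitz Λ γ β) (hΛ0 : ∀ k i, i ≤ k → 0 ≤ Λ k i) (hΛρ : ∀ k i, i ≤ k → Λ k i ≤ ρ (k - i))
    (hlo : BetaLowerH b γ β) :
    (∀ m, Tendsto (fun n => g (n + m) n) atTop (𝓝 (gstar g m))) ∧ (∀ m, 0 < gstar g m ∧ gstar g m ≤ γ) ∧ gstar g 0 = gIR
      ∧ (∀ m, Tendsto (fun n => β n (prefixOf (g (n + m + 1)) n)) atTop (𝓝 (bstar g m)))
      ∧ (∀ m, 1 / (gstar g (m + 1)) ^ 2 = 1 / (gstar g m) ^ 2 + bstar g m) ∧ (∀ m, b ≤ bstar g m)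
      ∧ (∀ m, gstar g m ≤ 1 / sprof gIR b m) := by
  have hB := sum_disc_diag_le g gIR hγ hb hσ0 hρ0 hσS hρW hsmall hrun hbox hpin hS hL hΛ0 hΛρ hlo
  exact ⟨tendsto_coupling_of_diag_le hB hbox, fun m => ⟨(gstar_pos_le_of_diag_le hB hbox m).1,
    (gstar_pos_le_of_diag_le hB hbox m).2.1⟩, gstar_zero_of_diag_le hB hbox hpin, tendsto_beta_diag_of_diag_le hB hrun,
    gstar_flow_of_diag_le hB hbox, le_bstar_of_diag_le hB hrun hbox hlo,
    fun m => (gstar_le_inv_sprof_of_diag_le hB hrun hbox hpin hlo hb.le m).2⟩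

end Summit.QuantumFields.BalabanUV.Beta.RemainderExplicitHistoryDiagonalExistence

end
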